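import Literature.Barriers.CriticalPhenomena.KozmaNachmiasRegeneration
import HarnessLib

/-!
# Kozma–Nachmias 2011, Lemma 3.1: the boundary connection sum at and above `p_c`

Barrier catalogue `Literature/Barriers/CriticalPhenomena/` (D-0021), first step of the programme
for Theorem 2 of Kozma–Nachmias 2011 (the residual named fact `KozmaNachmias2011_thm2` behind
`KozmaNachmias2011_oneArmUpper`, see `KozmaNachmiasLemma23.lean`). Chapter 3 of the source proves the
connection lower bound Lemma 1.1 from

> **Lemma 3.1.** Let `ℤ^d` be a bounded lattice in `ℝ^d`. Then, for any `p ≥ p_c` and any `r > 0`,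
> `Σ_{z ∈ ∂Q_r} P(0 ↔ z in Q_r) ≥ 1`.

(proof: otherwise a chain decomposition and BK give `E|C(0)| < ∞`, "well known" to imply `p < p_c`).
Here the lemma is PROVED, for the nearest-neighbour lattice `ℤ^d` (`d ≥ 2`) and every `p ≥ p_c`, in
the form `Σ_{z ∈ ∂Q_r} P_p(0 ↔ z in Q_r) ≥ 1/(2d)` — the constant is immaterial for its use in
Lemma 1.1 ("there exists some `y` such that `P(0 ↔ y in Q_M) ≥ c M^{1-d}`", (3.4)) — by a different,
sorry-free route available in this tree: Duminil-Copin–Tassion's functional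
`φ_p(S) = p Σ_{x ∈ S, y ∉ S, xy ∈ E} P_p(0 ↔ x in S)` satisfies `φ_p(S) ≥ 1` for every finite
`S ∋ 0` when `p > p̃_c = p_c` (definition of `p̃_c`, `DCT16_tildeCriticalProb_eq_criticalProb_holds`),
hence also at `p = p_c` by continuity of `p ↦ φ_p(S)` (a polynomial); and
`φ_p(Q_r) ≤ 2d Σ_{z ∈ ∂Q_r} P_p(0 ↔ z in Q_r)` since only boundary sites have neighbours outside
`Q_r`, at most `2d` of them.

* `continuous_phi`, `one_le_phi_of_criticalProb_lt`, `one_le_phi_criticalProbI`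
  (`φ_{p_c}(S) ≥ 1` for finite `S ∋ 0`, `d ≥ 2`);
* `sum_sphere_real_openConnIn_ge` — Lemma 3.1 in the form above.

## References

* G. Kozma, A. Nachmias, J. Amer. Math. Soc. 24 (2011) 375–409: Lemma 3.1 (p. 384) and its use in
  the proof of Lemma 1.1 ((3.4), p. 386).
* H. Duminil-Copin, V. Tassion, Enseign. Math. 62 (2016) 199–206, §1 (`φ_p(S)`, `p̃_c`), Thm. 1.1.
-/

noncomputable section

namespace Literature.Barriers.CriticalPhenomena

open _root_.MeasureTheory Finset Literature.Probability.LatticeModels Literature.Probability.Percolation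
  Literature.Probability.Percolation.DCT16
open scoped _root_.Topology

variable {d : ℕ}

/-! ### `φ_p(S) ≥ 1` at and above `p_c` -/

/-- `p ↦ φ_p(S)` is continuous on `[0, 1]` (each `P_p(0 ↔ x in S)` is a polynomial in `p`, being the
probability of an event determined by the finitely many pairs inside `S`).
[cite: DuminilCopinTassionEM2016, §1 (definition of φ_p(S))] -/
theorem continuous_phi (S : Finset (Site d)) : Continuous fun p : unitInterval => phi p S := by
  unfold phi
  refine continuous_subtype_val.mul ?_
  refine continuous_finsetSum _ fun x _ => continuous_finsetSum _ fun y _ => ?_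
  exact continuous_bondPercolation_real_of_determinedBy (zdGraph d)
    (determinedBy_openConnIn (↑S : Set (Site d)) (0 : Site d) x (K := ↑S.sym2)
      (by rw [Finset.coe_sym2]))

/-- **Above `p_c`, `φ_p(S) ≥ 1` for every finite `S ∋ 0`** (`d ≥ 2`): otherwise `p` would belong to
the set defining `p̃_c`, so `p ≤ p̃_c = p_c` (Duminil-Copin–Tassion 2016, definition of `p̃_c` and
Thm. 1.1, `p̃_c = p_c`). [cite: DuminilCopinTassionEM2016, Thm. 1.1 (p̃_c = p_c)] -/
theorem one_le_phi_of_criticalProb_lt (hd : 2 ≤ d) (q : unitInterval)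
    (hq : criticalProb (zdGraph d) (0 : Site d) < q) (S : Finset (Site d)) (h0S : (0 : Site d) ∈ S) :
    1 ≤ phi q S := by
  by_contra hφ
  push Not at hφ
  have hqt : (q : ℝ) ≤ tildeCriticalProb d :=
    le_csSup (bddAbove_tildeSet d) ⟨q.2, S, h0S, by simpa using hφ⟩
  rw [DCT16_tildeCriticalProb_eq_criticalProb_holds hd] at hqt
  linarith

/-- **At `p_c`, `φ_{p_c}(S) ≥ 1` for every finite `S ∋ 0`** (`d ≥ 2`): the set
`{p : φ_p(S) < 1}` is open (continuity of `φ_·(S)`) and `p_c < 1`, so if it contained `p_c` it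
would contain some `p > p_c`, contradicting `one_le_phi_of_criticalProb_lt`. This is Lemma 3.1 of
Kozma–Nachmias 2011 at `p = p_c` in Duminil-Copin–Tassion's formulation.
[cite: KozmaNachmias2011, Lemma 3.1] -/
theorem one_le_phi_criticalProbI (hd : 2 ≤ d) (S : Finset (Site d)) (h0S : (0 : Site d) ∈ S) :
    1 ≤ phi (criticalProbI d) S := by
  by_contra hφ
  push Not at hφ
  set pc : ℝ := criticalProb (zdGraph d) (0 : Site d) with hpc
  have hpc0 : 0 ≤ pc := (criticalProb_mem_Icc (zdGraph d) (0 : Site d)).1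
  have hpc1 : pc < 1 := criticalProb_zd_lt_one hd
  -- the real-parameter version of `φ_·(S)`
  set f : ℝ → ℝ := fun t => phi (Set.projIcc (0 : ℝ) 1 zero_le_one t) S with hf
  have hfc : Continuous f := (continuous_phi S).comp continuous_projIcc
  have hfpc : f pc < 1 := by
    have : Set.projIcc (0 : ℝ) 1 zero_le_one pc = criticalProbI d :=
      Set.projIcc_of_mem zero_le_one (criticalProb_mem_Icc (zdGraph d) (0 : Site d))
    simp only [hf, this]
    exact hφ
  obtain ⟨δ, hδ, hball⟩ := Metric.continuousAt_iff.1 hfc.continuousAt (1 - f pc) (by linarith)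
  -- a point slightly above `p_c`
  set t : ℝ := min (pc + δ / 2) ((pc + 1) / 2) with ht
  have htpc : pc < t := lt_min (by linarith) (by linarith)
  have ht1 : t < 1 := (min_le_right _ _).trans_lt (by linarith)
  have htδ : dist t pc < δ := by
    rw [Real.dist_eq, abs_of_pos (by linarith)]
    linarith [min_le_left (pc + δ / 2) ((pc + 1) / 2)]
  have hft : f t < 1 := by
    have h := hball htδ
    rw [Real.dist_eq] at h
    linarith [abs_sub_lt_iff.1 h]
  have ht01 : t ∈ unitInterval := ⟨hpc0.trans htpc.le, ht1.le⟩
  have hproj : Set.projIcc (0 : ℝ) 1 zero_le_one t = ⟨t, ht01⟩ := Set.projIcc_of_mem zero_le_one ht01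
  have h1 : 1 ≤ f t := by
    simp only [hf, hproj]
    exact one_le_phi_of_criticalProb_lt hd ⟨t, ht01⟩ htpc S h0S
  linarith

/-! ### Lemma 3.1 -/

/-- `φ_p(Q_r) ≤ 2d · Σ_{z ∈ ∂Q_r} P_p(0 ↔ z in Q_r)`: only the sites of `∂Q_r` have neighbours outside
`Q_r`, and at most `2d` of them (`d ≥ 1`). [folklore] -/
theorem phi_box_le_sum_sphere (hd : 1 ≤ d) (p : unitInterval) (r : ℕ) :
    phi p (box d r) ≤
      2 * d * ∑ z ∈ sphere d r, (bondPercolation (zdGraph d) p).real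
        (openConnIn (↑(box d r) : Set (Site d)) 0 z) := by
  rw [phi_def]
  have hsum : ∑ x ∈ box d r, ∑ y ∈ (zdGraph d).neighborFinset x with y ∉ box d r,
      (bondPercolation (zdGraph d) p).real (openConnIn (↑(box d r) : Set (Site d)) 0 x) ≤
        2 * d * ∑ z ∈ sphere d r, (bondPercolation (zdGraph d) p).real
          (openConnIn (↑(box d r) : Set (Site d)) 0 z) := by
    rw [Finset.mul_sum, ← Finset.sum_subset (sphere_subset_box d r)]
    · refine Finset.sum_le_sum fun x _ => ?_
      rw [Finset.sum_const, nsmul_eq_mul]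
      refine mul_le_mul_of_nonneg_right ?_ measureReal_nonneg
      have h1 : #(((zdGraph d).neighborFinset x).filter (· ∉ box d r)) ≤ 2 * d :=
        (Finset.card_filter_le _ _).trans
          ((SimpleGraph.card_neighborFinset_eq_degree _ x).le.trans (degree_zdGraph_le x))
      exact_mod_cast h1
    · intro x hx hxs
      have : ((zdGraph d).neighborFinset x).filter (· ∉ box d r) = ∅ := by
        rw [Finset.filter_eq_empty_iff]
        intro y hy hyS
        rw [SimpleGraph.mem_neighborFinset] at hy
        exact hxs (mem_sphere_of_adj_not_mem_box hd hx hyS hy)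
      rw [this, Finset.sum_empty]
  calc (p : ℝ) * ∑ x ∈ box d r, ∑ y ∈ (zdGraph d).neighborFinset x with y ∉ box d r,
        (bondPercolation (zdGraph d) p).real (openConnIn (↑(box d r) : Set (Site d)) 0 x)
      ≤ 1 * ∑ x ∈ box d r, ∑ y ∈ (zdGraph d).neighborFinset x with y ∉ box d r,
        (bondPercolation (zdGraph d) p).real (openConnIn (↑(box d r) : Set (Site d)) 0 x) :=
        mul_le_mul_of_nonneg_right (unitInterval.le_one p)
          (Finset.sum_nonneg fun _ _ => Finset.sum_nonneg fun _ _ => measureReal_nonneg)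
    _ ≤ _ := by rw [one_mul]; exact hsum

/-- **Kozma–Nachmias 2011, Lemma 3.1** (p. 384: "for any `p ≥ p_c` and any `r > 0`,
`Σ_{z ∈ ∂Q_r} P(0 ↔ z in Q_r) ≥ 1`"), PROVED for the nearest-neighbour lattice `ℤ^d`, `d ≥ 2`, and
every `p ≥ p_c`, with the constant `1/(2d)` in place of `1` (immaterial for its application (3.4) in
the proof of Lemma 1.1): `Σ_{z ∈ ∂Q_r} P_p(0 ↔ z in Q_r) ≥ 1/(2d)`, from `φ_p(Q_r) ≥ 1`
(Duminil-Copin–Tassion) and `φ_p(Q_r) ≤ 2d Σ_{z ∈ ∂Q_r} P_p(0 ↔ z in Q_r)`.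
[cite: KozmaNachmias2011, Lemma 3.1] -/
theorem sum_sphere_real_openConnIn_ge (hd : 2 ≤ d) (p : unitInterval)
    (hp : criticalProb (zdGraph d) (0 : Site d) ≤ p) (r : ℕ) :
    1 / (2 * d) ≤ ∑ z ∈ sphere d r, (bondPercolation (zdGraph d) p).real
      (openConnIn (↑(box d r) : Set (Site d)) 0 z) := by
  have hd0 : (0 : ℝ) < d := by exact_mod_cast (show 0 < d by omega)
  have hphi : 1 ≤ phi p (box d r) := by
    rcases hp.lt_or_eq with hlt | heq
    · exact one_le_phi_of_criticalProb_lt hd p hlt (box d r) (zero_mem_box d r)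
    · have : p = criticalProbI d := Subtype.ext heq.symm
      rw [this]
      exact one_le_phi_criticalProbI hd (box d r) (zero_mem_box d r)
  have h := hphi.trans (phi_box_le_sum_sphere (by omega) p r)
  rw [div_le_iff₀' (by positivity)]
  exact h

end Literature.Barriers.CriticalPhenomena

end
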